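import Summits.HodgeConjecture.HodgeConjecture.Theorems.PadicSemiregularLiftGrothendieckExistenceDescent
import Literature.AlgebraicGeometry.Motives.SupersingularAbelianVariety
import HarnessLib

/-!
# Transport of a carried class to the complex variety, and the glue
# "seeds spanning a Hodge-origin class ⟹ the carried class is algebraic"
# (helper for `AnchorsAtGenericHodgeLocusPoints`, stmt-HodgeConjecture-13944)

Route `PadicSemiregularLift` of `HodgeConjecture`, informal support item P2b
`AnchorsAtGenericHodgeLocusPoints`. An anchor `(𝒳/W(k), τ : K → ℂ, e : Y ≅ X_K ⊗_{K,τ} ℂ)` CARRIES a complex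
class `β ∈ H²ʳ(Y(ℂ); ℂ)` when there are a de Rham class `α ∈ Fʳ H²ʳ_dR(X_K/K)`, `φ`-Tate on the nose, and a
rational Betti class `t` with `iso_τ (1 ⊗ α) = (2πi)ʳ · (1 ⊗ t)` ("of Hodge origin", Deligne's twist as in
`PeriodRealization.IsHodgeRelativeTo` / `iso_cycleClass`) and `e^*(t ⊗ 1) = β` (typed transcription attached
to the item as evidence, `AnchorsAtGenericHodgeLocusPointsTyping.lean`). This file supplies, over IMPORTABLE
vocabulary only (`Motives.CrystallineRealization`, `Motives.PeriodRealization`, the P3 Theorems file), the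
glue by which the route's assembly nodes (`FermatAnchorAssembly`, `AbelianAnchorAssembly`, rev 18) consume
such an anchor. The TRANSPORT of `α ∈ Hⁱ_dR(X/K)` to `Y` is the chain of the P3 file,
`e^*(B.comparison (iso_τ (1 ⊗ α)))` (Grothendieck's comparison, the complexified Betti comparison, pull-back
along `e`); in the lemmas Grothendieck's comparison enters as an argument `ι` read in `B.W`-form
(`(P.B.comap τ).obj X i` is by definition `P.B.W.obj (X ⊗_τ ℂ) i`; fixing that spelling is what lets the
chain rewrite), instantiated with `P.iso τ X i` in the glue. No definitions are introduced.

* `transport_add`, `transport_smul`: the transport is `τ`-SEMILINEAR (`iso_τ` is `ℂ`-linear,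
  `1 ⊗ (c • α) = c • (1 ⊗ α)`), hence `transport_mem_algebraicClasses_of_mem_span_sup`: the classes whose
  transport is algebraic are closed under `K`-spans (`HodgeTheory.algebraicClasses Y r` is a `ℂ`-subspace);
* `transport_eq_of_eq`: a Hodge-origin class (`ι (1 ⊗ α) = (2πi)ʳ (1 ⊗ t)`) transports to
  `(2πi)ʳ · e^*(t ⊗ 1)`; `equiv_twoPiI_pow_smul_mem_algebraicClasses_iff`: the twist does not affect
  algebraicity;
* **`mem_algebraicClasses_of_seedSpan`** (the glue): if `α` lies in the `K`-span of the Berthelot–Ogus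
  images `bo chᵣ^cris(E_i)` of finitely many sheaves `E_i` on the special fibre that EXTEND to vector bundles
  on `𝒳` (`LiftsTo` — the output of P1 + P3a on seeds) plus the Lefschetz classes `Lefʳ(X_K)`, and
  `iso_τ (1 ⊗ α) = (2πi)ʳ (1 ⊗ t)`, then `e^*(t ⊗ 1)` is ALGEBRAIC on `Y`: seeds by the proved P3 chain
  (`grothendieckExistenceDescent_of_iso`), Lefschetz classes by `lefschetzClasses_le_algebraicClasses` + P3
  (b)(c), their `K`-span by semilinearity, and the `(2πi)ʳ` is absorbed. With `e^*(t ⊗ 1) = β` this is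
  "`β` is algebraic", the conclusion the assembly wants at the anchor (`mem_algebraicClasses_of_seedSpan_of_eq`).

All statements are for EVERY value of the hypothesis structures (no named facts).

References: A. Grothendieck, *On the de Rham cohomology of algebraic varieties*, Publ. IHÉS 29 (1966),
Thm. 1' [Grothendieck1966]; P. Deligne, *Hodge cycles on abelian varieties*, LNM 900 (1982), §1, §2
[Deligne1982]; P. Berthelot, A. Ogus, Invent. Math. 72 (1983), Cor. 3.7 [BerthelotOgus1983];
S. Bloch, H. Esnault, M. Kerz, Invent. Math. 195 (2014), §1 [BlochEsnaultKerz2014pAdic].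
-/

-- the summit-side namespace `Summit.HodgeConjecture.HodgeConjecture.…` (summit = sub-problem, D-0017)
-- repeats a component by design; the linter would flag every declaration.
set_option linter.dupNamespace false

noncomputable section

open CategoryTheory AlgebraicGeometry
open scoped TensorProduct Isocrystal
open Literature.AlgebraicGeometry Literature.AlgebraicGeometry.Motives
open Literature.AlgebraicGeometry.Motives.WittScheme Literature.AlgebraicGeometry.HodgeTheory
open Summit.HodgeConjecture.HodgeConjecture.Theorems.GrothendieckExistenceDescent

namespace Summit.HodgeConjecture.HodgeConjecture.Theorems.AnchorsAtGenericHodgeLocusPoints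

/-! ### Two scalar identities in `AlongHom ℂ τ` -/

section Scalars

variable {K : Type} [Field K] (τ : K →+* ℂ)

/-- `AlongHom.equiv τ ∘ algebraMap K (AlongHom ℂ τ) = τ` (both sides read `ℂ` identically). [folklore] -/
theorem equiv_algebraMap (c : K) : AlongHom.equiv τ (algebraMap K (AlongHom ℂ τ) c) = τ c :=
  rfl

/-- `(2πi)ʳ ≠ 0` in `ℂ` (read through `AlongHom.equiv`). [folklore] -/
theorem equiv_twoPiI_pow_ne_zero (r : ℕ) : AlongHom.equiv τ (twoPiI τ ^ r) ≠ 0 :=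
  (map_ne_zero_iff _ (AlongHom.equiv τ).injective).2 (pow_ne_zero r (isUnit_twoPiI τ).ne_zero)

/-- Algebraicity is insensitive to the twist: `(2πi)ʳ · c` is algebraic iff `c` is (`algebraicClasses` is a
`ℂ`-subspace, `(2πi)ʳ ≠ 0`). [cite: Deligne1982, §1] -/
theorem equiv_twoPiI_pow_smul_mem_algebraicClasses_iff {Y : SchemeOver ℂ} (r : ℕ)
    (c : complexBetti Y (2 * r)) :
    AlongHom.equiv τ (twoPiI τ ^ r) • c ∈ algebraicClasses Y r ↔ c ∈ algebraicClasses Y r :=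
  Submodule.smul_mem_iff _ (equiv_twoPiI_pow_ne_zero τ r)

end Scalars

/-! ### The transport of a de Rham class to the complex variety is `τ`-semilinear -/

section Transport

variable {K : Type} [Field K] [CharZero K] (P : PeriodRealization K) (τ : K →+* ℂ) (X : SchemeOver K)
  {Y : SchemeOver ℂ} (e : Y ≅ (baseChangeHom τ).obj X)

/-- **The transport is additive.** The transport of `α ∈ Hⁱ_dR(X/K)` to `Y ≅ X ⊗_{K,τ} ℂ` is
`e^*(comparison (iso_τ (1 ⊗ α)))` (the chain of the P3 file); it is additive. The comparison `iso_τ` is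
taken as an argument `ι` READ IN `B.W`-FORM (`(P.B.comap τ).obj X i` is by definition
`P.B.W.obj (X ⊗_τ ℂ) i`), to be instantiated with `P.iso τ X i`. [cite: Deligne1982, §1] -/
theorem transport_add (i : ℕ)
    (ι : AlongHom ℂ τ ⊗[K] P.dR.obj X i →ₗ[AlongHom ℂ τ] AlongHom ℂ τ ⊗[ℚ] P.B.W.obj ((baseChangeHom τ).obj X) i)
    (α α' : P.dR.obj X i) :
    complexBetti.map e.hom i (P.B.comparison ((baseChangeHom τ).obj X) i
        (alongHomTensorEquiv τ (P.B.W.obj ((baseChangeHom τ).obj X) i) (ι ((1 : AlongHom ℂ τ) ⊗ₜ[K] (α + α'))))) =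
      complexBetti.map e.hom i (P.B.comparison ((baseChangeHom τ).obj X) i
        (alongHomTensorEquiv τ (P.B.W.obj ((baseChangeHom τ).obj X) i) (ι ((1 : AlongHom ℂ τ) ⊗ₜ[K] α)))) +
      complexBetti.map e.hom i (P.B.comparison ((baseChangeHom τ).obj X) i
        (alongHomTensorEquiv τ (P.B.W.obj ((baseChangeHom τ).obj X) i) (ι ((1 : AlongHom ℂ τ) ⊗ₜ[K] α')))) := by
  simp only [TensorProduct.tmul_add, map_add]

/-- **The transport is `τ`-semilinear**: `transport (c • α) = τ(c) • transport α` (`iso_τ` is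
`ℂ`-linear and `1 ⊗ (c • α) = c • (1 ⊗ α)`; Deligne 1982, §1). [cite: Deligne1982, §1] -/
theorem transport_smul (i : ℕ)
    (ι : AlongHom ℂ τ ⊗[K] P.dR.obj X i →ₗ[AlongHom ℂ τ] AlongHom ℂ τ ⊗[ℚ] P.B.W.obj ((baseChangeHom τ).obj X) i)
    (c : K) (α : P.dR.obj X i) :
    complexBetti.map e.hom i (P.B.comparison ((baseChangeHom τ).obj X) i
        (alongHomTensorEquiv τ (P.B.W.obj ((baseChangeHom τ).obj X) i) (ι ((1 : AlongHom ℂ τ) ⊗ₜ[K] (c • α))))) =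
      (τ c) • complexBetti.map e.hom i (P.B.comparison ((baseChangeHom τ).obj X) i
        (alongHomTensorEquiv τ (P.B.W.obj ((baseChangeHom τ).obj X) i) (ι ((1 : AlongHom ℂ τ) ⊗ₜ[K] α)))) := by
  rw [one_tmul_smul_eq_algebraMap_smul, map_smul, alongHomTensorEquiv_smul, map_smul, equiv_algebraMap,
    map_smul]

/-- **Transport of a Hodge-origin class.** If `ι (1 ⊗ α) = (2πi)ʳ · (1 ⊗ t)` for a rational Betti class
`t ∈ H²ʳ_B(X_τ; ℚ)` (Deligne's normalisation, `iso_cycleClass`), then the transport of `α` is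
`(2πi)ʳ · e^*(t ⊗ 1)` (`B.comparison (1 ⊗ t) = B.toComplexBetti t`). [cite: Deligne1982, §1] -/
theorem transport_eq_of_eq (r : ℕ)
    (ι : AlongHom ℂ τ ⊗[K] P.dR.obj X (2 * r) →ₗ[AlongHom ℂ τ]
      AlongHom ℂ τ ⊗[ℚ] P.B.W.obj ((baseChangeHom τ).obj X) (2 * r))
    (α : P.dR.obj X (2 * r)) (t : P.B.W.obj ((baseChangeHom τ).obj X) (2 * r))
    (h : ι ((1 : AlongHom ℂ τ) ⊗ₜ[K] α) = twoPiI τ ^ r • ((1 : AlongHom ℂ τ) ⊗ₜ[ℚ] t)) :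
    complexBetti.map e.hom (2 * r) (P.B.comparison ((baseChangeHom τ).obj X) (2 * r)
        (alongHomTensorEquiv τ (P.B.W.obj ((baseChangeHom τ).obj X) (2 * r)) (ι ((1 : AlongHom ℂ τ) ⊗ₜ[K] α)))) =
      AlongHom.equiv τ (twoPiI τ ^ r) •
        complexBetti.map e.hom (2 * r) (P.B.toComplexBetti ((baseChangeHom τ).obj X) (2 * r) t) := by
  rw [h, alongHomTensorEquiv_smul, map_smul, alongHomTensorEquiv_tmul, map_one,
    BettiHodgeData.comparison_tmul, one_smul, ← BettiHodgeData.toComplexBetti_apply, map_smul]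

/-- **The classes with algebraic transport are closed under the `K`-span**: if every element of a set `S`
of de Rham classes and every element of a submodule `L` transport into `algebraicClasses Y r`, so does every
element of `K · S + L` (semilinearity; `algebraicClasses Y r` is a `ℂ`-subspace). [cite: Deligne1982, §1] -/
theorem transport_mem_algebraicClasses_of_mem_span_sup (r : ℕ)
    (ι : AlongHom ℂ τ ⊗[K] P.dR.obj X (2 * r) →ₗ[AlongHom ℂ τ]
      AlongHom ℂ τ ⊗[ℚ] P.B.W.obj ((baseChangeHom τ).obj X) (2 * r))
    {S : Set (P.dR.obj X (2 * r))} {L : Submodule K (P.dR.obj X (2 * r))}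
    (hS : ∀ α ∈ S, complexBetti.map e.hom (2 * r) (P.B.comparison ((baseChangeHom τ).obj X) (2 * r)
        (alongHomTensorEquiv τ (P.B.W.obj ((baseChangeHom τ).obj X) (2 * r)) (ι ((1 : AlongHom ℂ τ) ⊗ₜ[K] α)))) ∈
      algebraicClasses Y r)
    (hL : ∀ α ∈ L, complexBetti.map e.hom (2 * r) (P.B.comparison ((baseChangeHom τ).obj X) (2 * r)
        (alongHomTensorEquiv τ (P.B.W.obj ((baseChangeHom τ).obj X) (2 * r)) (ι ((1 : AlongHom ℂ τ) ⊗ₜ[K] α)))) ∈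
      algebraicClasses Y r)
    {α : P.dR.obj X (2 * r)} (hα : α ∈ Submodule.span K S ⊔ L) :
    complexBetti.map e.hom (2 * r) (P.B.comparison ((baseChangeHom τ).obj X) (2 * r)
        (alongHomTensorEquiv τ (P.B.W.obj ((baseChangeHom τ).obj X) (2 * r)) (ι ((1 : AlongHom ℂ τ) ⊗ₜ[K] α)))) ∈
      algebraicClasses Y r := by
  -- the preimage of `algebraicClasses Y r` under the (semilinear) transport, as a `K`-submodule
  let M : Submodule K (P.dR.obj X (2 * r)) :=
    { carrier := {β | complexBetti.map e.hom (2 * r) (P.B.comparison ((baseChangeHom τ).obj X) (2 * r)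
          (alongHomTensorEquiv τ (P.B.W.obj ((baseChangeHom τ).obj X) (2 * r))
            (ι ((1 : AlongHom ℂ τ) ⊗ₜ[K] β)))) ∈ algebraicClasses Y r}
      add_mem' := by
        intro a b ha hb
        simp only [Set.mem_setOf_eq, transport_add]
        exact add_mem ha hb
      zero_mem' := by
        simp only [Set.mem_setOf_eq, TensorProduct.tmul_zero, map_zero]
        exact zero_mem _
      smul_mem' := by
        intro c a ha
        simp only [Set.mem_setOf_eq, transport_smul]
        exact Submodule.smul_mem _ _ ha }
  have hle : Submodule.span K S ⊔ L ≤ M := sup_le (Submodule.span_le.2 hS) hL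
  exact hle hα

end Transport

/-! ### The glue: seeds spanning a Hodge-origin class make the carried class algebraic -/

section Glue

variable {p : ℕ} [Fact p.Prime] {k : Type} [Field k] [CharP k p] [PerfectRing k p]

/-- **Seeds spanning a Hodge-origin class ⟹ the carried complex class is algebraic.** Let `C` be a
crystalline realization over `k`, `P` a period realization over `K = W(k)[1/p]` sharing its de Rham
realization (`hPC`) with summit-compatible Betti datum (`hPB`), `𝒳/W(k)` a smooth proper model, `τ : K → ℂ`,
`e : Y ≅ X_K ⊗_{K,τ} ℂ`. If `α ∈ H²ʳ_dR(X_K/K)` lies in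
`K·span{bo chᵣ^cris(E_i)} + Lefʳ(X_K)` for finitely many sheaves `E_i` on the special fibre that EXTEND to
vector bundles on `𝒳` (`LiftsTo`: what P1 + P3a produce from seeds), and
`iso_τ (1 ⊗ α) = (2πi)ʳ · (1 ⊗ t)` for a rational Betti class `t` (Hodge origin), then `e^*(t ⊗ 1)` lies in
`algebraicClasses Y r`: the seeds transport into `algebraicClasses` by the proved P3 chain
(`grothendieckExistenceDescent_of_iso`: Berthelot–Ogus `bo ch^cris = ch^dR`, Grothendieck's `ch^dR`
algebraic, comparison with cycle classes), the Lefschetz classes by `lefschetzClasses_le_algebraicClasses` and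
P3 (b)(c), their `K`-span by `τ`-semilinearity (`transport_mem_algebraicClasses_of_mem_span_sup`), and the
factor `(2πi)ʳ` is absorbed (`transport_eq_of_eq`). [cite: BlochEsnaultKerz2014pAdic, §1 p. 3]
[cite: Deligne1982, §1] [cite: BerthelotOgus1983, Cor. 3.7 and Rem. 3.7.1] -/
theorem mem_algebraicClasses_of_seedSpan (C : CrystallineRealization p k) (P : PeriodRealization K(p, k))
    (hPC : P.dR = C.dR) (hPB : P.B.IsComparisonCompatible) {n : ℕ} {𝒳 : SchemeOver (WittVector p k)}
    (h𝒳 : IsSmoothProperModel n 𝒳) (τ : K(p, k) →+* ℂ) {Y : SchemeOver ℂ}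
    (e : Y ≅ (baseChangeHom τ).obj (genericFibre 𝒳)) {r m : ℕ}
    (E : Fin m → (specialFibre 𝒳).left.Modules) (hE : ∀ i, LiftsTo 𝒳 (E i))
    {α : C.dR.obj (genericFibre 𝒳) (2 * r)}
    (hspan : α ∈ Submodule.span K(p, k)
        (Set.range fun i => C.bo 𝒳 (2 * r) (C.chCris (specialFibre 𝒳) (E i) r)) ⊔
      C.dR.lefschetzClasses (genericFibre 𝒳) r)
    (t : P.B.W.obj ((baseChangeHom τ).obj (genericFibre 𝒳)) (2 * r))
    (hiso : P.iso τ (genericFibre 𝒳) (2 * r) ((1 : AlongHom ℂ τ) ⊗ₜ[K(p, k)] (hPC ▸ α)) =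
      twoPiI τ ^ r • ((1 : AlongHom ℂ τ) ⊗ₜ[ℚ] t)) :
    complexBetti.map e.hom (2 * r) (P.B.toComplexBetti ((baseChangeHom τ).obj (genericFibre 𝒳)) (2 * r) t) ∈
      algebraicClasses Y r := by
  -- make `P.dR = C.dR` definitional (as in the P3 file); `t`, `hiso` depend on `P`, so re-introduce them after
  revert t
  obtain ⟨dR, B, iso, isoInv, h₁, h₂, h₃, h₄, h₅, h₆, h₇, h₈⟩ := P
  dsimp only at hPC
  subst hPC
  set P' : PeriodRealization K(p, k) := ⟨C.dR, B, iso, isoInv, h₁, h₂, h₃, h₄, h₅, h₆, h₇, h₈⟩ with hP'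
  intro t hiso
  have hXK : IsSmoothProjective n (genericFibre 𝒳) := h𝒳.isSmoothProjective_genericFibre
  -- Grothendieck's comparison read in `B.W`-form
  have hιdef : ∃ ι : AlongHom ℂ τ ⊗[K(p, k)] P'.dR.obj (genericFibre 𝒳) (2 * r) →ₗ[AlongHom ℂ τ]
      AlongHom ℂ τ ⊗[ℚ] P'.B.W.obj ((baseChangeHom τ).obj (genericFibre 𝒳)) (2 * r),
      ∀ x, ι x = P'.iso τ (genericFibre 𝒳) (2 * r) x := ⟨P'.iso τ (genericFibre 𝒳) (2 * r), fun _ => rfl⟩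
  obtain ⟨ι, hι⟩ := hιdef
  -- the seed span and the Lefschetz classes have algebraic transport
  have hmem := transport_mem_algebraicClasses_of_mem_span_sup P' τ (genericFibre 𝒳) e r ι
    (S := Set.range fun i => C.bo 𝒳 (2 * r) (C.chCris (specialFibre 𝒳) (E i) r))
    (L := C.dR.lefschetzClasses (genericFibre 𝒳) r) ?_ ?_ hspan
  rotate_left
  · rintro _ ⟨i, rfl⟩
    rw [hι]
    exact grothendieckExistenceDescent_of_iso C P' rfl hPB h𝒳 (hE i) τ r e
  · intro z hz
    rw [hι]
    exact map_mem_algebraicClasses_of_isOpenImmersion (IsSmoothProjective.baseChangeHom_holds τ hXK) e.hom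
      (comparison_iso_mem_algebraicClasses_of_mem_algebraicClasses P' hPB h𝒳 τ r
        (C.dR.lefschetzClasses_le_algebraicClasses hXK r hz))
  -- the transport of `α` is `(2πi)ʳ · e^*(t ⊗ 1)`
  have hiso' : ι ((1 : AlongHom ℂ τ) ⊗ₜ[K(p, k)] α) = twoPiI τ ^ r • ((1 : AlongHom ℂ τ) ⊗ₜ[ℚ] t) := by
    rw [hι]
    exact hiso
  rw [transport_eq_of_eq P' τ (genericFibre 𝒳) e r ι α t hiso'] at hmem
  exact (equiv_twoPiI_pow_smul_mem_algebraicClasses_iff τ r _).1 hmem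

/-- The same with the carried class named: if moreover `e^*(t ⊗ 1) = β`, then `β ∈ algebraicClasses Y r` —
the conclusion the route's assembly nodes (`FermatAnchorAssembly`, `AbelianAnchorAssembly`) need at an
anchor carrying `β` (P2c `HodgeLocusPropagation` then propagates it in the abelian case).
[cite: BlochEsnaultKerz2014pAdic, §1 p. 3] -/
theorem mem_algebraicClasses_of_seedSpan_of_eq (C : CrystallineRealization p k) (P : PeriodRealization K(p, k))
    (hPC : P.dR = C.dR) (hPB : P.B.IsComparisonCompatible) {n : ℕ} {𝒳 : SchemeOver (WittVector p k)}
    (h𝒳 : IsSmoothProperModel n 𝒳) (τ : K(p, k) →+* ℂ) {Y : SchemeOver ℂ}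
    (e : Y ≅ (baseChangeHom τ).obj (genericFibre 𝒳)) {r m : ℕ}
    (E : Fin m → (specialFibre 𝒳).left.Modules) (hE : ∀ i, LiftsTo 𝒳 (E i))
    {α : C.dR.obj (genericFibre 𝒳) (2 * r)}
    (hspan : α ∈ Submodule.span K(p, k)
        (Set.range fun i => C.bo 𝒳 (2 * r) (C.chCris (specialFibre 𝒳) (E i) r)) ⊔
      C.dR.lefschetzClasses (genericFibre 𝒳) r)
    (t : P.B.W.obj ((baseChangeHom τ).obj (genericFibre 𝒳)) (2 * r))
    (hiso : P.iso τ (genericFibre 𝒳) (2 * r) ((1 : AlongHom ℂ τ) ⊗ₜ[K(p, k)] (hPC ▸ α)) =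
      twoPiI τ ^ r • ((1 : AlongHom ℂ τ) ⊗ₜ[ℚ] t))
    {β : complexBetti Y (2 * r)}
    (hβ : complexBetti.map e.hom (2 * r)
      (P.B.toComplexBetti ((baseChangeHom τ).obj (genericFibre 𝒳)) (2 * r) t) = β) :
    β ∈ algebraicClasses Y r :=
  hβ ▸ mem_algebraicClasses_of_seedSpan C P hPC hPB h𝒳 τ e E hE hspan t hiso

end Glue

end Summit.HodgeConjecture.HodgeConjecture.Theorems.AnchorsAtGenericHodgeLocusPoints

end
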